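import Mathlib
import HarnessLib
import Summits.HubbardSuperconductivity.HubbardSuperconductivity.Theorems.KLProgrammeKLRegimeSplitSpin01
import Summits.HubbardSuperconductivity.HubbardSuperconductivity.Theorems.KLProgrammeKLRegimeSplitPairValueBridge

/-!
# Route `KLProgramme` — crux K3 split, child 1 on the S-slot `BetaSplitAtS = PairArrayAt ∧ EndpointLineS ∧ FirstMoments`
# (p1b's `KLProgrammeKLRegimeSplitSpin01`): the value line and the endpoint line CLOSED from (B1-v2) + (E5-S)
# (cell gate-hubbard-kl, seat p1 = C1 lead, g5)

* `quarticValueLineS_of_pairArrayAt`: the `(0,1)` value line at scale `n` follows from `PairArrayAt n` ALONE at EVERY configuration —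
  `(k₁, k₂, k₃)` is the pair kinematics `(k′, k, Q − k′)` with `k′ := k₁`, `k := k₂`, `Q := k₁ + k₃` (`klQuarticValue_pair`, p443794;
  `PairArrayAt` quantifies over all total momenta `Q`), provided `2|U| + C_W·U² ≤ Klam·|U|`.
* `endpointLineS_of`: (E5-S) `IsoTupleL1AtS n` with the SHARP bound `B = 2|U| + C_W U²` from `PairArrayAt n` gives `EndpointLineS n` once
  `CF·B + CF·(Klam U)² ≤ Klam·|U|` and `B ≤ Klam·|U|` (`klam_arith`-type side conditions, `KLProgrammeKLRegimeSplitChildOneClosers`).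
So on the S-slot child 1's (B2)/(value) part needs only row 0′ (`PairArrayAt` from the engine's ladder clauses, p3) and one (E5-S) call.
Pure bookkeeping; nothing about the model is asserted.
-/

noncomputable section

namespace Summit.HubbardSuperconductivity.HubbardSuperconductivity.Theorems.KLRegimeSplit

set_option linter.dupNamespace false -- summit = problem name (single-conjunct summit), D-0017

open Real Literature.MathematicalPhysics.QuantumLattice Literature.Probability.LatticeModels

section Model

variable (L M : ℕ) [NeZero L] [NeZero M]

/-- **The sharp `(0,1)` value bound from (B1-v2) at every configuration**: `PairArrayAt n` gives
`|λ_n^{↑↓}(k₁,k₂,k₃)| ≤ 2|U| + C_W U²` for all `k₁, k₂ ∈` ball and ALL `k₃` (total momentum `Q = k₁ + k₃` is arbitrary in `PairArrayAt`). -/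
theorem quarticValueS_le_of_pairArrayAt (P : SplitConsts) {β U μ : ℝ} {K : TrigPolyC4v} {n : ℕ} (h : PairArrayAt L M P β U μ K n)
    {k₁ k₂ : TorusSite 2 L} (hk₁ : k₁ ∈ klBall L μ K) (hk₂ : k₂ ∈ klBall L μ K) (k₃ : TorusSite 2 L) :
    ‖klQuarticValue L M β U μ K n 0 1 k₁ k₂ k₃‖ ≤ 2 * |U| + P.C_W * U ^ 2 := by
  have hk₃ : k₃ = (k₁ + k₃) - k₁ := by abel
  rw [hk₃]
  exact quarticValue_pair_le_of_pairArrayAt L M P h (k₁ + k₃) hk₂ hk₁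

/-- **The `(0,1)` value line from (B1-v2) alone** (given `2|U| + C_W U² ≤ Klam·|U|`). -/
theorem quarticValueLineS_of_pairArrayAt (P : SplitConsts) {β U μ : ℝ} {K : TrigPolyC4v} {n : ℕ} (h : PairArrayAt L M P β U μ K n)
    (hK : 2 * |U| + P.C_W * U ^ 2 ≤ P.Klam * |U|) : QuarticValueLineS L M P β U μ K n :=
  fun _ hk₁ _ hk₂ k₃ _ => (quarticValueS_le_of_pairArrayAt L M P h hk₁ hk₂ k₃).trans hK

/-- **`EndpointLineS n` from (B1-v2) + (E5-S)**: with `B := 2|U| + C_W U²`, if `CF·B + CF·(Klam U)² ≤ Klam·|U|` and `B ≤ Klam·|U|`,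
`PairArrayAt n ∧ IsoTupleL1AtS n` give the isotropic endpoint norm line and the `(0,1)` value line at scale `n`. -/
theorem endpointLineS_of {G : GeoConsts} (P : SplitConsts) {β U μ : ℝ} {K : TrigPolyC4v} {n : ℕ} (hU : 0 ≤ 2 * |U| + P.C_W * U ^ 2)
    (hpair : PairArrayAt L M P β U μ K n) (hiso : IsoTupleL1AtS L M G P β U μ K n)
    (harith : G.CF * (2 * |U| + P.C_W * U ^ 2) + G.CF * (P.Klam * U) ^ 2 ≤ P.Klam * |U|)
    (hK : 2 * |U| + P.C_W * U ^ 2 ≤ P.Klam * |U|) : EndpointLineS L M P β U μ K n := by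
  refine ⟨?_, quarticValueLineS_of_pairArrayAt L M P hpair hK⟩
  intro Ω hΩ x₁
  have h' := hiso (2 * |U| + P.C_W * U ^ 2) hU
    (fun k₁ hk₁ k₂ hk₂ k₃ _ => quarticValueS_le_of_pairArrayAt L M P hpair hk₁ hk₂ k₃) n le_rfl Ω hΩ x₁
  rw [klIsoKernelAt_self] at h'
  exact h'.trans harith

end Model

end Summit.HubbardSuperconductivity.HubbardSuperconductivity.Theorems.KLRegimeSplit

end
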